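import Mathlib
import Summits.PneNP.PneNP.Theses.OverlapGapAlgebra
import Summits.PneNP.PneNP.Theorems.OverlapGapAlgebraSolvableImpliesStableSectionSmoothSection
import Summits.PneNP.PneNP.Theorems.OverlapGapAlgebraSolvableImpliesStableSectionEtaGeOne
import Summits.PneNP.PneNP.Theorems.OverlapGapAlgebraSolvableImpliesStableSectionConstSection
import Summits.PneNP.PneNP.Theorems.OverlapGapAlgebraSolvableImpliesStableSectionLowDensity
import Summits.PneNP.PneNP.Theorems.OverlapGapAlgebraSolvableImpliesStableSectionFirstMoment
import Summits.PneNP.PneNP.Theorems.OverlapGapAlgebraSolvableImpliesStableSectionRepairAssembly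

/-!
# Line `Sketch` for crux stmt-PneNP-2463 (`SolvableImpliesStableSection`) — lead's skeleton, v4

v4 (continuation lead c2, 2026-08-16).  The crux is split BY REGIME (v3, lead c1); everything but the
core is landed:

* `η ≥ 1` (`solvableImpliesStableSection_of_eta_ge_one`, p111240), `ν > 2^{-k}`
  (`solvableImpliesStableSection_of_nu_gt`, p110051), `α ≤ 1/(32k²)` (`conclusion_low_density`, p116451),
  hypothesis false for `α ≥ 2^k log 2` (`sissFM_hyp_false_of_density_ge_log_two`, p117229), smooth
  sections give the conclusion (`concl_of_smoothSection`, p109844 — the engine of v1/v2).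
* NEW in v4, f-free and provable: the block "ONE ROUND OF LOCAL REPAIR" (stubs 2–7).  The 1-local map
  `g₁ Φ v := [v is the first variable of some all-positive clause of Φ]` (flip, in the all-`false`
  assignment, the first variable of every violated clause) is `2`-Lipschitz per single-literal change
  (`stub_repairLipschitz`) and violates in the mean at most
  `2^{-k}((1 + 2^{-k}((1+1/n)^k - 1))^m - 1)·m` clauses (`stub_repairClauseFibre`: the clause fibre is
  `(n+|F|)^k - n^k`; `stub_rerandomize`: re-randomising one clause; `stub_repairProductCount`: the
  product/MGF count over the other clauses), which tends to `2^{-k}(e^{kα2^{-k}} - 1)·m`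
  (`stub_repairAsymptotics`).  Efron–Stein for Lipschitz maps (`shwLip_sum_sq_dev_le`), the maximum
  clause-degree second moment (`shwL_sum_maxdeg_sq_le`), Chebyshev from the mean, and the walk engine with
  growing loss (`engine_count`, `sissLip_asy_pointwise`, `sissLip_numerics`) then give the crux's
  CONCLUSION unconditionally for every `k ≥ 1`, `α, η > 0`, `c > 0` and every
  `ν > ν₁(k, α) := 2^{-k}(e^{kα2^{-k}} - 1)` (`stub_repairAssembly`, held by the lead) — sharpening the
  constant section (`ν > 2^{-k}`) by the factor `e^{kα2^{-k}} - 1 < 1` exactly when `α < 2^k log 2 / k`.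
* The parked core `stub_transferCore` = v3's core further restricted to `ν ≤ ν₁(k, α)` and
  `α < 2^k log 2`: the crux's non-relativizing content (inside the Bresler–Huang window it is equivalent to
  `¬ hypothesis` given item 2462, `transfer_false_without_polyTime`; crux-sized).

v4.2 (after wave 1, 2026-08-16T18:45Z): the whole block LANDED — `stub_repairLipschitz` p119304,
`stub_repairClauseFibre` p119297, `stub_rerandomize` p119349, `stub_repairProductCount` p119515,
`stub_repairAsymptotics` p119526 (wave-1 workers), `ra_sum_indicator_le` (mean bound, `…RepairMean.lean`)
p119895 and the assembly `stub_repairAssembly` (`…RepairAssembly.lean`, p120110, lead) — and is now imported;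
the ONLY open stub is `stub_transferCore` (the crux core on the residual strip).

`SolvableImpliesStableSection_of` = case split on the regime; sorries only in `stub_*`.
-/

set_option linter.dupNamespace false

namespace Summit.PneNP.PneNP.Cruxes.SolvableImpliesStableSection.Sketch

open Finset
open scoped Classical

/-- **Stub 1 — the TRANSFER CORE (parked; crux-sized).** v3's core restricted to the residual strip
`1/(32k²) < α < 2^k log 2`, `0 < η < 1`, `0 < ν ≤ min (2^{-k}, 2^{-k}(e^{kα2^{-k}} - 1))`: efficient
solvability with non-vanishing probability ⇒ a smooth section (typically `ν`-valid map with `O(1)` total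
`ηn`-jump rate) infinitely often.  Inside the Bresler–Huang window this is equivalent to the failure of
the hypothesis (`transfer_false_without_polyTime`, modulo item 2462), so any proof must use `IsPolyTime`
white-box; below the window it asks for smooth sections at EVERY `ν > 0`. -/
theorem stub_transferCore (k : ℕ) (hk : 3 ≤ k) (α η ν : ℝ) (hαlo : 1 / (32 * (k : ℝ) ^ 2) < α)
    (hαhi : α < (2 : ℝ) ^ k * Real.log 2)
    (hη : 0 < η) (hη1 : η < 1) (hν : 0 < ν) (hν1 : ν ≤ (1 / 2 : ℝ) ^ k)
    (hν2 : ν ≤ (1 / 2 : ℝ) ^ k * (Real.exp (k * α * (1 / 2 : ℝ) ^ k) - 1))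
    (hsolv : ∃ f : List Bool → List Bool, Literature.Computability.Complexity.IsPolyTime f ∧
      ∃ ε : ℝ, 0 < ε ∧ ∃ᶠ n : ℕ in Filter.atTop, ∀ m : ℕ, m = ⌊α * n⌋₊ → ε ≤
        ((Finset.univ.filter fun Φ : Fin m → Fin k → Fin n × Bool => ∀ i, ∃ j,
          (f (Literature.Computability.Complexity.encodingCNF.encode (List.ofFn fun a =>
            List.ofFn fun b => (((Φ a b).1 : ℕ), (Φ a b).2)))).getD (Φ i j).1 false =
              (Φ i j).2).card : ℝ) / Fintype.card (Fin m → Fin k → Fin n × Bool)) :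
    ∃ A : ℝ, 0 < A ∧ ∃ᶠ n : ℕ in Filter.atTop, ∀ m : ℕ, m = ⌊α * n⌋₊ →
      ∃ g : (Fin m → Fin k → Fin n × Bool) → (Fin n → Bool),
      ∃ G : Finset (Fin m → Fin k → Fin n × Bool),
        (∀ Φ ∈ G, (((Finset.univ : Finset (Fin m)).filter fun i =>
            ∀ j, g Φ (Φ i j).1 ≠ (Φ i j).2).card : ℝ) ≤ ν * m) ∧
        ((k * m : ℕ) : ℝ) * (Gᶜ.card : ℝ) ≤ A * Fintype.card (Fin m → Fin k → Fin n × Bool) ∧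
        (∑ a : Fin m, ∑ b : Fin k,
            (((Finset.univ : Finset ((Fin m → Fin k → Fin n × Bool) × (Fin n × Bool))).filter
              fun p => η * n < hammingDist (g p.1)
                (g (Function.update p.1 a (Function.update (p.1 a) b p.2)))).card : ℝ))
          ≤ A * (Fintype.card (Fin m → Fin k → Fin n × Bool) * (2 * n)) := by
  sorry

/-! ## Block "one round of local repair" (stubs 2–7, f-free): LANDED, imported from
`Theorems/OverlapGapAlgebraSolvableImpliesStableSection{RepairLipschitz,RepairClauseFibre,Rerandomize,
RepairProductCount,RepairAsymptotics,RepairMean,RepairAssembly}.lean`. -/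

/-- **The crux from the stubs (v4):** case split on the regime.  `α ≥ 2^k log 2`: the hypothesis is
false (`sissFM_hyp_false_of_density_ge_log_two`).  Low density `α ≤ 1/(32k²)`: `conclusion_low_density`.
`η ≥ 1`: `solvableImpliesStableSection_of_eta_ge_one`.  `ν > 2^{-k}`: `solvableImpliesStableSection_of_nu_gt`.
`ν > 2^{-k}(e^{kα2^{-k}} - 1)`: the one-round repair block `stub_repairAssembly`.  Otherwise the parked
core `stub_transferCore` gives a smooth section and `concl_of_smoothSection` (engine, landed) the path
event. -/
theorem SolvableImpliesStableSection_of :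
    Summit.PneNP.PneNP.Theses.OverlapGapAlgebra.SolvableImpliesStableSection := by
  intro k hk α η ν hα hη hν hsolv c hc
  have hk1 : 1 ≤ k := by omega
  by_cases hhi : (2 : ℝ) ^ k * Real.log 2 ≤ α
  · exact absurd hsolv (Summit.PneNP.PneNP.Theorems.sissFM_hyp_false_of_density_ge_log_two k hk1 α hhi)
  by_cases hlow : α ≤ 1 / (32 * (k : ℝ) ^ 2)
  · exact (conclusion_low_density k hk α η ν hα hlow hη hν.le c hc).frequently
  by_cases hη1 : 1 ≤ η
  · obtain ⟨f, -, ε, hε, hfreq⟩ := hsolv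
    exact solvableImpliesStableSection_of_eta_ge_one k hk1 α η ν hα hη1 hν ⟨f, ε, hε, hfreq⟩ c hc
  by_cases hν1 : (1 / 2 : ℝ) ^ k < ν
  · exact solvableImpliesStableSection_of_nu_gt k hk1 α η ν hα hη hν1 c hc
  by_cases hν2 : (1 / 2 : ℝ) ^ k * (Real.exp (k * α * (1 / 2 : ℝ) ^ k) - 1) < ν
  · exact (stub_repairAssembly k hk1 α η ν hα hη hν2 c hc).frequently
  obtain ⟨A, hA, hsm⟩ := stub_transferCore k hk α η ν (lt_of_not_ge hlow) (lt_of_not_ge hhi) hη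
    (lt_of_not_ge hη1) hν (le_of_not_gt hν1) (le_of_not_gt hν2) hsolv
  exact concl_of_smoothSection k hk1 α η ν A hα hη.le hA hsm c hc

end Summit.PneNP.PneNP.Cruxes.SolvableImpliesStableSection.Sketch
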